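import Mathlib
import HarnessLib
import Literature.MathematicalPhysics.QuantumLattice.GaugeGroups
import Literature.Analysis.Matrix.DetExp
import Summits.Ventures.LatticeQCDFlow.Exactness.HaarStein
import Summits.Ventures.LatticeQCDFlow.Exactness.CompactHaar

/-!
# The sphere Stein identity with linear test functions (the CP(N−1) site residual), via rotations `exp(tL) ∈ SO(d)`

HONEST FRAMING: exact (Metropolis-corrected) sampling algorithms for lattice gauge theory;
figures of merit are autocorrelation/cost numbers at stated couplings and volumes; no
continuum-physics claim.

Venture `LatticeQCDFlow` (cell pub-lqcd), topic `Exactness`, FANOUT row 9 (eng-latcore; the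
engine's `schwinger_dyson.residual_fields_cpn_2d` SITE residual, chain columns `obs_sd_site_re/im`,
checked so far only by quadrature `vmf_identity_quadrature`).  NEW WORK of the cell over Mathlib and
the tree's `Literature.Analysis.Matrix.DetExp`; nothing is cited as a fact.  Printed counterparts,
named only: Stein's identity on the sphere / the von Mises–Fisher second-moment identity.

The engine's CP(N−1) site law is `∝ e^{κ Re F†z} dσ(z)` on the unit sphere of `ℂ^N ≅ ℝ^d`,
`d = 2N`, and its residual rests on `∫ [Δ_S f + ⟨∇_S (κ F·x), ∇_S f⟩] e^{κ F·x} dσ = 0` for the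
LINEAR test functions `f = b·x` (`Δ_S f = −(d−1) f`, `⟨∇_S g, ∇_S f⟩ = F·b − (F·x)(b·x)`).  Here
the sphere law is realised as the ORBIT LAW `x = O e` of a fixed vector `e` under the Haar
probability of `SO(d)` (for `|e| = 1` this is the normalised surface measure — that identification
is the dictionary, not typed here), and the identity is proved exactly as the gauge-link one
(`HaarSteinSpecialUnitary.lean`, `SchwingerDysonResidual.lean`): the Haar–Stein identity
(`gibbs_stein`) along the rotation `t ↦ exp(tL)`, `Lᵀ = −L` (in `SO(d)` by Liouville's formula),
summed over the rotation generators `L_ij = E_ij − E_ji` with the two pieces of algebra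
`½ Σ_ij b·(L_ij L_ij x) = −(d−1) b·x` and the Lagrange identity
`½ Σ_ij (u·L_ij p)(v·L_ij q) = (u·v)(p·q) − (u·q)(p·v)`.

## Content (`m` a finite index type, `d = card m`; `O ∈ SO(d)`, `x = O e`; `F b e u : m → ℝ`)

* `exp_smul_mem_specialOrthogonalGroup` — `Lᵀ = −L ⇒ exp(tL) ∈ SO(d)`; `expCurveSO`.
* `hasDerivAt_dot_exp_smul_mulVec` — `d/dt u·(exp(tL) y) = u·(L exp(tL) y)` (entrywise).
* `abs_dot_mulVec_le_of_mem_orthogonalGroup` — `|u·(V y)| ≤ Σ |u i| |y j|` for orthogonal `V`.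
* **`specialOrthogonal_stein`** — one generator:
  `∫ [u·(L x) + κ (u·x)(F·(L x))] e^{κ F·x} dμ(O) = 0`.
* `rotGen i j = E_ij − E_ji`, `dot_rotGen_mulVec`, `rotSum_dot_sq` (`½ Σ b·(L L x) = −(d−1) b·x`),
  `rotSum_lagrange` (the Lagrange identity).
* **`sphere_stein_linear`** — the summed identity:
  `∫ [−(d−1) (b·x) + κ ((b·F)(e·e) − (b·x)(F·x))] e^{κ F·x} dμ(O) = 0`;
  for `e·e = 1` and `b = F` this is the engine's `Re R_site = κ(|F|² − t_R²) − (d−1) t_R`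
  (`t_R = F·x`), and `b ⊥ F` gives `Im R_site`.

Not here: the identification of the `SO(d)`-orbit law with the surface measure (uniqueness of the
rotation-invariant probability on the sphere), the realification `ℂ^N ≅ ℝ^{2N}`, the link (circle)
part of the CP(N−1) residual (`SteinCircle.lean`), statistical power.
-/

namespace Summit.Ventures.LatticeQCDFlow.Exactness

open Matrix NormedSpace MeasureTheory Metric Finset
open scoped Topology

variable {m : Type*} [Fintype m] [DecidableEq m]

/-! ## §1 The rotation `t ↦ exp(tL)` in `SO(d)` -/

omit [DecidableEq m] in
/-- An antisymmetric real matrix is traceless. -/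
theorem trace_eq_zero_of_transpose_eq_neg {L : Matrix m m ℝ} (hL : Lᵀ = -L) : L.trace = 0 := by
  have h : L.trace = -L.trace := by
    conv_lhs => rw [← Matrix.trace_transpose L, hL, Matrix.trace_neg]
  linarith

/-- `exp(tL) ∈ SO(d)` for antisymmetric `L` and real `t` (orthogonality from `(exp tL)ᵀ = exp(−tL)`,
determinant one from Liouville's formula `det exp = exp tr`). -/
theorem exp_smul_mem_specialOrthogonalGroup {L : Matrix m m ℝ} (hL : Lᵀ = -L) (t : ℝ) :
    exp (t • L) ∈ Matrix.specialOrthogonalGroup m ℝ := by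
  rw [Matrix.mem_specialOrthogonalGroup_iff]
  refine ⟨?_, ?_⟩
  · have hL' : (t • L)ᴴ = -(t • L) := by
      rw [Matrix.conjTranspose_eq_transpose_of_trivial, Matrix.transpose_smul, hL, smul_neg]
    rw [Matrix.mem_unitaryGroup_iff, Matrix.star_eq_conjTranspose, ← Matrix.exp_conjTranspose, hL',
      ← Matrix.exp_add_of_commute (t • L) (-(t • L)) ((Commute.refl (t • L)).neg_right),
      add_neg_cancel, exp_zero]
  · rw [Literature.Analysis.Matrix.det_exp_eq_exp_trace, Matrix.trace_smul,
      trace_eq_zero_of_transpose_eq_neg hL, smul_zero, exp_zero]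

/-- The one-parameter rotation `t ↦ exp(tL)` in `SO(d)` (`L` antisymmetric). -/
noncomputable def expCurveSO (L : Matrix m m ℝ) (hL : Lᵀ = -L) (t : ℝ) :
    Matrix.specialOrthogonalGroup m ℝ :=
  ⟨exp (t • L), exp_smul_mem_specialOrthogonalGroup hL t⟩

/-- Underlying matrix of the rotation. -/
@[simp] theorem coe_expCurveSO {L : Matrix m m ℝ} (hL : Lᵀ = -L) (t : ℝ) :
    (↑(expCurveSO L hL t) : Matrix m m ℝ) = exp (t • L) := rfl

/-- The rotation starts at the identity. -/
theorem expCurveSO_zero {L : Matrix m m ℝ} (hL : Lᵀ = -L) : expCurveSO L hL 0 = 1 :=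
  Subtype.ext (by simp [exp_zero])

/-! ## §2 Derivative of the linear observables along the rotation (entrywise, no matrix norm) -/

/-- **`d/dt u·(exp(tL) y) = u·(L exp(tL) y)`.** -/
theorem hasDerivAt_dot_exp_smul_mulVec (L : Matrix m m ℝ) (u y : m → ℝ) (t : ℝ) :
    HasDerivAt (fun s : ℝ => u ⬝ᵥ (exp (s • L) *ᵥ y)) (u ⬝ᵥ ((L * exp (t • L)) *ᵥ y)) t := by
  have hcomm : exp (t • L) * L = L * exp (t • L) :=
    (((Commute.refl L).smul_right t).exp_right).eq.symm
  rw [← hcomm, dot_mulVec_eq_sum_sum]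
  have hfun : (fun s : ℝ => u ⬝ᵥ (exp (s • L) *ᵥ y)) = fun s => ∑ j, ∑ i, u i * exp (s • L) i j * y j :=
    funext fun s => dot_mulVec_eq_sum_sum _ _ _
  rw [hfun]
  exact HasDerivAt.fun_sum fun j _ => HasDerivAt.fun_sum fun i _ =>
    ((Literature.Analysis.Matrix.hasDerivAt_exp_smul_apply L i j t).const_mul (u i)).mul_const (y j)

/-! ## §3 Bounds: entries of an orthogonal matrix are at most one -/

omit [DecidableEq m] in
/-- `|u·(V y)| ≤ Σ_j Σ_i |u i| |y j|` for `V ∈ O(d)`. -/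
theorem abs_dot_mulVec_le_of_mem_orthogonalGroup [DecidableEq m] {V : Matrix m m ℝ}
    (hV : V ∈ Matrix.orthogonalGroup m ℝ) (u y : m → ℝ) :
    |u ⬝ᵥ (V *ᵥ y)| ≤ ∑ j, ∑ i, |u i| * |y j| := by
  rw [dot_mulVec_eq_sum_sum]
  refine (abs_sum_le_sum_abs _ _).trans (sum_le_sum fun j _ => ?_)
  refine (abs_sum_le_sum_abs _ _).trans (sum_le_sum fun i _ => ?_)
  rw [abs_mul, abs_mul]
  have h1 : |V i j| ≤ 1 := by
    have := entry_norm_bound_of_unitary hV i j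
    rwa [Real.norm_eq_abs] at this
  calc |u i| * |V i j| * |y j| ≤ |u i| * 1 * |y j| :=
        mul_le_mul_of_nonneg_right (mul_le_mul_of_nonneg_left h1 (abs_nonneg _)) (abs_nonneg _)
    _ = |u i| * |y j| := by rw [mul_one]

/-! ## §4 The one-generator Stein identity for the orbit law `x = O e` -/

/-- **One-generator sphere Stein identity.**  For the Haar probability `μ` of `SO(d)`, a fixed vector
`e`, every real `κ`, all `F u : m → ℝ` and every antisymmetric `L`, with `x = O e`:
`∫ [u·(L x) + κ (u·x)(F·(L x))] e^{κ F·x} dμ(O) = 0`. -/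
theorem specialOrthogonal_stein (κ : ℝ) (F u e : m → ℝ) (L : Matrix m m ℝ) (hL : Lᵀ = -L) :
    ∫ O, ((u ⬝ᵥ (L *ᵥ ((O : Matrix m m ℝ) *ᵥ e)))
        + κ * (u ⬝ᵥ ((O : Matrix m m ℝ) *ᵥ e)) * (F ⬝ᵥ (L *ᵥ ((O : Matrix m m ℝ) *ᵥ e))))
        * Real.exp (κ * (F ⬝ᵥ ((O : Matrix m m ℝ) *ᵥ e)))
      ∂(Literature.MathematicalPhysics.QuantumFieldTheory.haarProbability
          (Matrix.specialOrthogonalGroup m ℝ)) = 0 := by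
  set μ := Literature.MathematicalPhysics.QuantumFieldTheory.haarProbability
    (Matrix.specialOrthogonalGroup m ℝ)
  -- uniform bounds
  set βe := ∑ j : m, ∑ i : m, |u i| * |e j|
  set βeL := ∑ j : m, ∑ i : m, |(u ᵥ* L) i| * |e j|
  set βF := ∑ j : m, ∑ i : m, |F i| * |e j|
  set βFL := ∑ j : m, ∑ i : m, |(F ᵥ* L) i| * |e j|
  set Sβ := βe + βeL + βF + βFL with hS
  set C := (1 + |κ|) * Sβ with hCdef
  have hβe : 0 ≤ βe := by positivity
  have hβeL : 0 ≤ βeL := by positivity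
  have hβF : 0 ≤ βF := by positivity
  have hβFL : 0 ≤ βFL := by positivity
  have hS0 : 0 ≤ Sβ := by rw [hS]; positivity
  have hc1 : 1 ≤ 1 + |κ| := by linarith [abs_nonneg κ]
  have hcc : |κ| ≤ 1 + |κ| := by linarith
  have hc0 : 0 ≤ 1 + |κ| := by linarith [abs_nonneg κ]
  have le_C : ∀ x : ℝ, 0 ≤ x → x ≤ Sβ → x ≤ C := fun x hx hxS => by
    rw [hCdef]; calc x = 1 * x := (one_mul x).symm
      _ ≤ (1 + |κ|) * Sβ := mul_le_mul hc1 hxS hx hc0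
  have le_C' : ∀ x : ℝ, 0 ≤ x → x ≤ Sβ → |κ| * x ≤ C := fun x hx hxS => by
    rw [hCdef]; exact mul_le_mul hcc hxS hx hc0
  have hU : ∀ V : Matrix.specialOrthogonalGroup m ℝ, (V : Matrix m m ℝ) ∈ Matrix.orthogonalGroup m ℝ :=
    fun V => Matrix.specialUnitaryGroup_le_unitaryGroup V.2
  -- move the generator onto the test vector: u·(L z) = (u ᵥ* L)·z
  have mv : ∀ (v : m → ℝ) (z : m → ℝ), v ⬝ᵥ (L *ᵥ z) = (v ᵥ* L) ⬝ᵥ z :=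
    fun v z => dotProduct_mulVec v L z
  have hγU : ∀ (t : ℝ) (O : Matrix.specialOrthogonalGroup m ℝ),
      (↑(expCurveSO L hL t * O) : Matrix m m ℝ) = exp (t • L) * (O : Matrix m m ℝ) :=
    fun t O => by rw [Submonoid.coe_mul, coe_expCurveSO]
  have hcont : ∀ v : m → ℝ, Continuous fun O : Matrix.specialOrthogonalGroup m ℝ =>
      v ⬝ᵥ ((O : Matrix m m ℝ) *ᵥ e) := fun v =>
    (continuous_const.dotProduct (continuous_subtype_val.matrix_mulVec continuous_const))
  have hcontL : ∀ v : m → ℝ, Continuous fun O : Matrix.specialOrthogonalGroup m ℝ =>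
      v ⬝ᵥ ((L * (1 : Matrix m m ℝ)) *ᵥ ((O : Matrix m m ℝ) *ᵥ e)) := fun v =>
    (continuous_const.dotProduct (continuous_const.matrix_mulVec
      (continuous_subtype_val.matrix_mulVec continuous_const)))
  have key := gibbs_stein (μ := μ) (γ := expCurveSO L hL) (ε := 1) (C := C)
    (h := fun O => u ⬝ᵥ ((O : Matrix m m ℝ) *ᵥ e))
    (S := fun O => -(κ * (F ⬝ᵥ ((O : Matrix m m ℝ) *ᵥ e))))
    (Dh := fun t O => u ⬝ᵥ ((L * exp (t • L)) *ᵥ ((O : Matrix m m ℝ) *ᵥ e)))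
    (DS := fun t O => -(κ * (F ⬝ᵥ ((L * exp (t • L)) *ᵥ ((O : Matrix m m ℝ) *ᵥ e)))))
    one_pos (expCurveSO_zero hL) (hcont u).measurable ((hcont F).measurable.const_mul κ).neg
    ?_ ?_ ?_ ?_ ?_ ?_ ?_ ?_
  · -- conclusion
    have h0 : exp ((0 : ℝ) • L) = 1 := by rw [zero_smul, exp_zero]
    simp only [h0, Matrix.mul_one, neg_neg, mul_neg, sub_neg_eq_add] at key
    refine (integral_congr_ae (Filter.Eventually.of_forall fun O => ?_)).trans key
    ring
  · -- measurability of Dh 0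
    have h0 : exp ((0 : ℝ) • L) = 1 := by rw [zero_smul, exp_zero]
    simp only [h0]
    exact (hcontL u).measurable
  · have h0 : exp ((0 : ℝ) • L) = 1 := by rw [zero_smul, exp_zero]
    simp only [h0]
    exact ((hcontL F).measurable.const_mul κ).neg
  · -- derivative of h along the rotation
    intro O t _
    have hf : ∀ s : ℝ, (fun O : Matrix.specialOrthogonalGroup m ℝ => u ⬝ᵥ ((O : Matrix m m ℝ) *ᵥ e))
        (expCurveSO L hL s * O) = u ⬝ᵥ (exp (s • L) *ᵥ ((O : Matrix m m ℝ) *ᵥ e)) := by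
      intro s; simp only [hγU, Matrix.mulVec_mulVec]
    exact (hasDerivAt_dot_exp_smul_mulVec L u ((O : Matrix m m ℝ) *ᵥ e) t).congr_of_eventuallyEq
      (Filter.Eventually.of_forall hf)
  · -- derivative of S along the rotation
    intro O t _
    have hf : ∀ s : ℝ, (fun O : Matrix.specialOrthogonalGroup m ℝ =>
        -(κ * (F ⬝ᵥ ((O : Matrix m m ℝ) *ᵥ e)))) (expCurveSO L hL s * O)
        = -(κ * (F ⬝ᵥ (exp (s • L) *ᵥ ((O : Matrix m m ℝ) *ᵥ e)))) := by
      intro s; simp only [hγU, Matrix.mulVec_mulVec]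
    exact (((hasDerivAt_dot_exp_smul_mulVec L F ((O : Matrix m m ℝ) *ᵥ e) t).const_mul κ).neg
      ).congr_of_eventuallyEq (Filter.Eventually.of_forall hf)
  · -- |h O| ≤ C
    intro O
    exact (abs_dot_mulVec_le_of_mem_orthogonalGroup (hU O) u e).trans
      (le_C βe hβe (by rw [hS]; linarith))
  · -- |S O| ≤ C
    intro O
    rw [abs_neg, abs_mul]
    exact (mul_le_mul_of_nonneg_left (abs_dot_mulVec_le_of_mem_orthogonalGroup (hU O) F e)
      (abs_nonneg κ)).trans (le_C' βF hβF (by rw [hS]; linarith))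
  · -- |Dh t O| ≤ C
    intro O t _
    rw [← Matrix.mulVec_mulVec, mv, Matrix.mulVec_mulVec, ← hγU]
    exact (abs_dot_mulVec_le_of_mem_orthogonalGroup (hU _) _ e).trans
      (le_C βeL hβeL (by rw [hS]; linarith))
  · -- |DS t O| ≤ C
    intro O t _
    rw [abs_neg, abs_mul, ← Matrix.mulVec_mulVec, mv, Matrix.mulVec_mulVec, ← hγU]
    exact (mul_le_mul_of_nonneg_left (abs_dot_mulVec_le_of_mem_orthogonalGroup (hU _) _ e)
      (abs_nonneg κ)).trans (le_C' βFL hβFL (by rw [hS]; linarith))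

/-! ## §5 The rotation generators `L_ij = E_ij − E_ji` and their quadratic sums -/

/-- The rotation generator `L_ij = E_ij − E_ji`. -/
def rotGen (i j : m) : Matrix m m ℝ := single i j 1 - single j i 1

omit [Fintype m] in
/-- `L_ij` is antisymmetric. -/
theorem rotGen_transpose (i j : m) : (rotGen i j)ᵀ = -rotGen i j := by
  unfold rotGen
  rw [transpose_sub, transpose_single, transpose_single, neg_sub]

/-- `u·(L_ij x) = u i x j − u j x i`. -/
theorem dot_rotGen_mulVec (u x : m → ℝ) (i j : m) :
    u ⬝ᵥ (rotGen i j *ᵥ x) = u i * x j - u j * x i := by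
  unfold rotGen
  rw [Matrix.sub_mulVec, dotProduct_sub, single_mulVec_eq, single_mulVec_eq, dotProduct_smul,
    dotProduct_smul, dotProduct_single_one, dotProduct_single_one, smul_eq_mul, smul_eq_mul]
  ring

/-- Components of `L_ij x`: `(L_ij x) k = [k = i] x j − [k = j] x i`. -/
theorem rotGen_mulVec_apply (x : m → ℝ) (i j k : m) :
    (rotGen i j *ᵥ x) k = (if k = i then x j else 0) - (if k = j then x i else 0) := by
  unfold rotGen
  rw [Matrix.sub_mulVec, Pi.sub_apply, single_mulVec_eq, single_mulVec_eq]
  simp only [Pi.smul_apply, Pi.single_apply, smul_eq_mul, mul_ite, mul_one, mul_zero, one_mul]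

/-- **`½ Σ_ij b·(L_ij (L_ij x)) = −(d−1) b·x`** (`Σ_{i<j} L_ij² = −(d−1)·1` on vectors). -/
theorem rotSum_dot_sq (b x : m → ℝ) :
    ∑ i, ∑ j, (1 / 2 : ℝ) * (b ⬝ᵥ (rotGen i j *ᵥ (rotGen i j *ᵥ x)))
      = -((Fintype.card m : ℝ) - 1) * (b ⬝ᵥ x) := by
  have h : ∀ i j : m, b ⬝ᵥ (rotGen i j *ᵥ (rotGen i j *ᵥ x))
      = (b i * (if j = i then x j else 0) - b i * x i)
        - (b j * x j - b j * (if i = j then x i else 0)) := by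
    intro i j
    rw [dot_rotGen_mulVec, rotGen_mulVec_apply, rotGen_mulVec_apply]
    simp only [if_true]
    ring
  have inner : ∀ i : m, ∑ j, (1 / 2 : ℝ) * ((b i * (if j = i then x j else 0) - b i * x i)
      - (b j * x j - b j * (if i = j then x i else 0)))
      = (1 / 2 : ℝ) * (2 * (b i * x i) - (Fintype.card m : ℝ) * (b i * x i) - b ⬝ᵥ x) := by
    intro i
    rw [← mul_sum]
    simp only [sum_sub_distrib, mul_ite, mul_zero, sum_ite_eq', sum_ite_eq, mem_univ, if_true,
      sum_const, card_univ, nsmul_eq_mul, dotProduct]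
    ring
  simp_rw [h, inner]
  rw [← mul_sum]
  simp only [sum_sub_distrib, ← mul_sum, sum_const, card_univ, nsmul_eq_mul]
  simp only [dotProduct]
  ring

/-- **Lagrange identity for the rotation family:**
`½ Σ_ij (u·L_ij p)(v·L_ij q) = (u·v)(p·q) − (u·q)(p·v)`. -/
theorem rotSum_lagrange (u p v q : m → ℝ) :
    ∑ i, ∑ j, (1 / 2 : ℝ) * ((u ⬝ᵥ (rotGen i j *ᵥ p)) * (v ⬝ᵥ (rotGen i j *ᵥ q)))
      = (u ⬝ᵥ v) * (p ⬝ᵥ q) - (u ⬝ᵥ q) * (p ⬝ᵥ v) := by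
  simp_rw [dot_rotGen_mulVec]
  have h : ∀ i j : m, (1 / 2 : ℝ) * ((u i * p j - u j * p i) * (v i * q j - v j * q i))
      = (1 / 2 : ℝ) * ((u i * v i) * (p j * q j)) - (1 / 2 : ℝ) * ((u i * q i) * (p j * v j))
        - (1 / 2 : ℝ) * ((p i * v i) * (u j * q j)) + (1 / 2 : ℝ) * ((p i * q i) * (u j * v j)) := by
    intro i j; ring
  simp_rw [h]
  simp only [sum_add_distrib, sum_sub_distrib, ← mul_sum, ← sum_mul]
  simp only [dotProduct]
  ring

/-- `rotSum_lagrange` with a constant factor inside the sums. -/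
theorem rotSum_lagrange_const_mul (c : ℝ) (u p v q : m → ℝ) :
    ∑ i, ∑ j, c * ((1 / 2 : ℝ) * ((u ⬝ᵥ (rotGen i j *ᵥ p)) * (v ⬝ᵥ (rotGen i j *ᵥ q))))
      = c * ((u ⬝ᵥ v) * (p ⬝ᵥ q) - (u ⬝ᵥ q) * (p ⬝ᵥ v)) := by
  rw [← rotSum_lagrange, mul_sum]
  refine sum_congr rfl fun i _ => ?_
  rw [mul_sum]

/-! ## §6 The summed identity: the sphere Stein identity with linear test functions -/

omit [DecidableEq m] in
/-- Orthogonal matrices preserve the dot product: `(V e)·(V e) = e·e`. -/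
theorem dot_mulVec_self_of_mem_orthogonalGroup [DecidableEq m] {V : Matrix m m ℝ}
    (hV : V ∈ Matrix.orthogonalGroup m ℝ) (e : m → ℝ) : (V *ᵥ e) ⬝ᵥ (V *ᵥ e) = e ⬝ᵥ e := by
  have hVV : Vᵀ * V = 1 := by
    have h := Unitary.star_mul_self_of_mem hV
    rwa [Matrix.star_eq_conjTranspose, Matrix.conjTranspose_eq_transpose_of_trivial] at h
  rw [dotProduct_mulVec, ← Matrix.mulVec_transpose, Matrix.mulVec_mulVec, hVV, Matrix.one_mulVec]

/-- **Sphere Stein identity with linear test functions (the CP(N−1) site residual).**  For the Haar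
probability `μ` of `SO(d)`, `d = card m`, a fixed vector `e`, every real `κ` and all `F b : m → ℝ`,
with `x = O e`:
`∫ [−(d−1) (b·x) + κ ((b·F)(e·e) − (b·x)(F·x))] e^{κ F·x} dμ(O) = 0`. -/
theorem sphere_stein_linear (κ : ℝ) (F b e : m → ℝ) :
    ∫ O, (-((Fintype.card m : ℝ) - 1) * (b ⬝ᵥ ((O : Matrix m m ℝ) *ᵥ e))
        + κ * ((b ⬝ᵥ F) * (e ⬝ᵥ e)
          - (b ⬝ᵥ ((O : Matrix m m ℝ) *ᵥ e)) * (F ⬝ᵥ ((O : Matrix m m ℝ) *ᵥ e))))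
        * Real.exp (κ * (F ⬝ᵥ ((O : Matrix m m ℝ) *ᵥ e)))
      ∂(Literature.MathematicalPhysics.QuantumFieldTheory.haarProbability
          (Matrix.specialOrthogonalGroup m ℝ)) = 0 := by
  set μ := Literature.MathematicalPhysics.QuantumFieldTheory.haarProbability
    (Matrix.specialOrthogonalGroup m ℝ)
  -- the one-generator integrand with test vector `−L b`, i.e. observable `b·(L x)`
  obtain ⟨G, hG⟩ : ∃ G : m → m → Matrix.specialOrthogonalGroup m ℝ → ℝ, G =
      fun i j (O : Matrix.specialOrthogonalGroup m ℝ) =>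
      ((b ⬝ᵥ (rotGen i j *ᵥ (rotGen i j *ᵥ ((O : Matrix m m ℝ) *ᵥ e))))
        + κ * (b ⬝ᵥ (rotGen i j *ᵥ ((O : Matrix m m ℝ) *ᵥ e)))
          * (F ⬝ᵥ (rotGen i j *ᵥ ((O : Matrix m m ℝ) *ᵥ e))))
      * Real.exp (κ * (F ⬝ᵥ ((O : Matrix m m ℝ) *ᵥ e))) := ⟨_, rfl⟩
  -- each generator integrates to zero
  have hzero : ∀ i j : m, ∫ O, G i j O ∂μ = 0 := by
    intro i j
    have key := specialOrthogonal_stein κ F (-(rotGen i j *ᵥ b)) e (rotGen i j) (rotGen_transpose i j)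
    refine (integral_congr_ae (Filter.Eventually.of_forall fun O => ?_)).trans key
    -- (−L b)·z = b·(L z)
    have hmv : ∀ z : m → ℝ, (-(rotGen i j *ᵥ b)) ⬝ᵥ z = b ⬝ᵥ (rotGen i j *ᵥ z) := by
      intro z
      rw [← Matrix.neg_mulVec, ← rotGen_transpose, Matrix.mulVec_transpose, ← dotProduct_mulVec]
    simp only [hG, hmv]
  -- each integrand is continuous, hence integrable
  have hx : Continuous fun O : Matrix.specialOrthogonalGroup m ℝ => (O : Matrix m m ℝ) *ᵥ e :=
    continuous_subtype_val.matrix_mulVec continuous_const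
  have hint : ∀ i j : m, Integrable (G i j) μ := by
    intro i j
    rw [hG]
    refine Continuous.integrable_of_hasCompactSupport ?_ (HasCompactSupport.of_compactSpace _)
    exact ((continuous_const.dotProduct (continuous_const.matrix_mulVec
      (continuous_const.matrix_mulVec hx))).add ((continuous_const.mul (continuous_const.dotProduct
      (continuous_const.matrix_mulVec hx))).mul (continuous_const.dotProduct
      (continuous_const.matrix_mulVec hx)))).mul
      (Real.continuous_exp.comp (continuous_const.mul (continuous_const.dotProduct hx)))
  -- sum of zeros, pulled inside the integral
  have hsum : ∫ O, ∑ i, ∑ j, (1 / 2 : ℝ) * G i j O ∂μ = 0 := by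
    rw [integral_finsetSum _ fun i _ => integrable_finsetSum _ fun j _ => (hint i j).const_mul _]
    refine sum_eq_zero fun i _ => ?_
    rw [integral_finsetSum _ fun j _ => (hint i j).const_mul _]
    refine sum_eq_zero fun j _ => ?_
    rw [integral_const_mul, hzero, mul_zero]
  refine Eq.trans (integral_congr_ae (Filter.Eventually.of_forall fun O => ?_)) hsum
  -- pointwise: the summed integrand is the stated one
  simp only [hG]
  set x := (O : Matrix m m ℝ) *ᵥ e with hxdef
  have hO : x ⬝ᵥ x = e ⬝ᵥ e :=
    dot_mulVec_self_of_mem_orthogonalGroup (Matrix.specialUnitaryGroup_le_unitaryGroup O.2) e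
  have hsplit : ∀ i j : m, (1 / 2 : ℝ) * (((b ⬝ᵥ (rotGen i j *ᵥ (rotGen i j *ᵥ x)))
      + κ * (b ⬝ᵥ (rotGen i j *ᵥ x)) * (F ⬝ᵥ (rotGen i j *ᵥ x))) * Real.exp (κ * (F ⬝ᵥ x)))
      = ((1 / 2 : ℝ) * (b ⬝ᵥ (rotGen i j *ᵥ (rotGen i j *ᵥ x)))
        + κ * ((1 / 2 : ℝ) * ((b ⬝ᵥ (rotGen i j *ᵥ x)) * (F ⬝ᵥ (rotGen i j *ᵥ x)))))
        * Real.exp (κ * (F ⬝ᵥ x)) := by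
    intro i j; ring
  simp_rw [hsplit, ← sum_mul, sum_add_distrib]
  rw [rotSum_dot_sq, rotSum_lagrange_const_mul, hO, dotProduct_comm x F]

end Summit.Ventures.LatticeQCDFlow.Exactness
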